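import Mathlib.Analysis.SpecialFunctions.SmoothTransition
import Mathlib.Analysis.Calculus.IteratedDeriv.Lemmas
import Literature.NumberTheory.LFunctions.GaussianWeylPhase
import HarnessLib

/-!
# Smooth weights for the pieces of the Gaussian lattice sums: radial profiles and angular bumps, with
# two derivatives along lattice lines

Topic `Literature/NumberTheory/LFunctions`.  Everything here is PROVED; the definitions are explicit functions
(`VdC.stepS` = Mathlib's `Real.smoothTransition` and its first two derivatives, the positive-part cube
`VdC.pp3`, the dyadic window `VdC.dyadWin`, the radial profile `VdC.radProf`, the angular coordinate
`VdC.angLog` and the angular bump `VdC.angBump`) and the constants bounding the derivatives of the step.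

These are the building blocks of the weights `φ(z) = g₀(|z|²) · β(angle)` of the pieces of
`∑_z g(N z) λ^m(z) N(z)^{-it}` used in the proof of the Weyl-type bound for the Hecke `L`-functions of
`ℤ[i]`; the file provides, ALONG EVERY LATTICE LINE `a ↦ ad + ce`, two derivatives of each factor with
explicit bounds `O(1/R)`, `O(1/R²)` at distance `≍ R` from the origin.

## References

* E. C. Titchmarsh, *The lattice-points in a circle*, Proc. London Math. Soc. (2) 38 (1935), 96–115.
  [Titchmarsh1935Lattice]
* M. N. Huxley, *Area, Lattice Points, and Exponential Sums*, OUP 1996, §5 (smooth weights). [Huxley1996]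
-/

noncomputable section

open Real Set Metric Classical

namespace Literature.NumberTheory.LFunctions
namespace VdC

/-! ### The smooth step and its first two derivatives -/

/-- The smooth step `S` (`= Real.smoothTransition`: `0` on `(-∞,0]`, `1` on `[1,∞)`, `C^∞`). [folklore] -/
def stepS : ℝ → ℝ := Real.smoothTransition

/-- `S'`. [folklore] -/
def stepS₁ : ℝ → ℝ := deriv stepS

/-- `S''`. [folklore] -/
def stepS₂ : ℝ → ℝ := deriv stepS₁

/-- `S` is `C^∞`. [folklore] -/
theorem contDiff_stepS : ContDiff ℝ (⊤ : ℕ∞) stepS := Real.smoothTransition.contDiff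

/-- `S'` is `C^∞`. [folklore] -/
theorem contDiff_stepS₁ : ContDiff ℝ (⊤ : ℕ∞) stepS₁ := by
  have h := contDiff_stepS.iterate_deriv 1
  simpa [stepS₁] using h

/-- `S''` is `C^∞`. [folklore] -/
theorem contDiff_stepS₂ : ContDiff ℝ (⊤ : ℕ∞) stepS₂ := by
  have h := contDiff_stepS₁.iterate_deriv 1
  simpa [stepS₂] using h

/-- `S' ` is the derivative of `S`. [folklore] -/
theorem hasDerivAt_stepS (x : ℝ) : HasDerivAt stepS (stepS₁ x) x :=
  ((contDiff_stepS.differentiable (by simp)) x).hasDerivAt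

/-- `S''` is the derivative of `S'`. [folklore] -/
theorem hasDerivAt_stepS₁ (x : ℝ) : HasDerivAt stepS₁ (stepS₂ x) x :=
  ((contDiff_stepS₁.differentiable (by simp)) x).hasDerivAt

/-- `S''` is continuous. [folklore] -/
theorem continuous_stepS₂ : Continuous stepS₂ := contDiff_stepS₂.continuous

/-- `S'` is continuous. [folklore] -/
theorem continuous_stepS₁ : Continuous stepS₁ := contDiff_stepS₁.continuous

/-- `0 ≤ S ≤ 1`. [folklore] -/
theorem stepS_mem (x : ℝ) : 0 ≤ stepS x ∧ stepS x ≤ 1 :=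
  ⟨Real.smoothTransition.nonneg x, Real.smoothTransition.le_one x⟩

/-- `|S| ≤ 1`. [folklore] -/
theorem abs_stepS_le (x : ℝ) : |stepS x| ≤ 1 := by
  rw [abs_le]; have := stepS_mem x; constructor <;> linarith

/-- `S = 0` on `(-∞, 0]`. [folklore] -/
theorem stepS_of_nonpos {x : ℝ} (hx : x ≤ 0) : stepS x = 0 := Real.smoothTransition.zero_of_nonpos hx

/-- `S = 1` on `[1, ∞)`. [folklore] -/
theorem stepS_of_one_le {x : ℝ} (hx : 1 ≤ x) : stepS x = 1 := Real.smoothTransition.one_of_one_le hx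

/-- `S(x) + S(1 - x) = 1`. [folklore] -/
theorem stepS_add_stepS_one_sub (x : ℝ) : stepS x + stepS (1 - x) = 1 := by
  have h := Real.smoothTransition.pos_denom x
  simp only [stepS, Real.smoothTransition, sub_sub_cancel]
  rw [add_comm (expNegInvGlue (1 - x)) (expNegInvGlue x)]
  field_simp

/-- `S'` vanishes off `(0, 1)`. [folklore] -/
theorem stepS₁_eq_zero {x : ℝ} (hx : x ≤ 0 ∨ 1 ≤ x) : stepS₁ x = 0 := by
  -- `S'` is continuous and vanishes on the open sets `x < 0`, `x > 1`
  have hopen : ∀ y : ℝ, (y < 0 ∨ 1 < y) → stepS₁ y = 0 := by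
    intro y hy
    rcases hy with hy | hy
    · have hev : stepS =ᶠ[nhds y] fun _ => (0 : ℝ) := by
        filter_upwards [(isOpen_Iio (a := (0 : ℝ))).mem_nhds hy] with t ht
        exact stepS_of_nonpos (le_of_lt ht)
      rw [stepS₁, hev.deriv_eq]; simp
    · have hev : stepS =ᶠ[nhds y] fun _ => (1 : ℝ) := by
        filter_upwards [(isOpen_Ioi (a := (1 : ℝ))).mem_nhds hy] with t ht
        exact stepS_of_one_le (le_of_lt ht)
      rw [stepS₁, hev.deriv_eq]; simp
  rcases hx with hx | hx
  · rcases lt_or_eq_of_le hx with h | h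
    · exact hopen x (Or.inl h)
    · -- `x = 0`: limit from the left
      subst h
      have htend : Filter.Tendsto stepS₁ (nhdsWithin 0 (Iio 0)) (nhds (stepS₁ 0)) :=
        continuous_stepS₁.continuousAt.continuousWithinAt.tendsto
      have hev : stepS₁ =ᶠ[nhdsWithin 0 (Iio 0)] fun _ => (0 : ℝ) :=
        eventually_nhdsWithin_of_forall fun y hy => hopen y (Or.inl hy)
      have h2 := htend.congr' hev
      exact tendsto_nhds_unique h2 tendsto_const_nhds
  · rcases lt_or_eq_of_le hx with h | h
    · exact hopen x (Or.inr h)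
    · subst h
      have htend : Filter.Tendsto stepS₁ (nhdsWithin 1 (Ioi 1)) (nhds (stepS₁ 1)) :=
        continuous_stepS₁.continuousAt.continuousWithinAt.tendsto
      have hev : stepS₁ =ᶠ[nhdsWithin 1 (Ioi 1)] fun _ => (0 : ℝ) :=
        eventually_nhdsWithin_of_forall fun y hy => hopen y (Or.inr hy)
      have h2 := htend.congr' hev
      exact tendsto_nhds_unique h2 tendsto_const_nhds

/-- `S''` vanishes off `(0, 1)`. [folklore] -/
theorem stepS₂_eq_zero {x : ℝ} (hx : x ≤ 0 ∨ 1 ≤ x) : stepS₂ x = 0 := by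
  have hopen : ∀ y : ℝ, (y < 0 ∨ 1 < y) → stepS₂ y = 0 := by
    intro y hy
    have hev : stepS₁ =ᶠ[nhds y] fun _ => (0 : ℝ) := by
      rcases hy with hy | hy
      · filter_upwards [(isOpen_Iio (a := (0 : ℝ))).mem_nhds hy] with t ht
        exact stepS₁_eq_zero (Or.inl ht.le)
      · filter_upwards [(isOpen_Ioi (a := (1 : ℝ))).mem_nhds hy] with t ht
        exact stepS₁_eq_zero (Or.inr ht.le)
    rw [stepS₂, hev.deriv_eq]; simp
  rcases hx with hx | hx
  · rcases lt_or_eq_of_le hx with h | h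
    · exact hopen x (Or.inl h)
    · subst h
      have htend : Filter.Tendsto stepS₂ (nhdsWithin 0 (Iio 0)) (nhds (stepS₂ 0)) :=
        continuous_stepS₂.continuousAt.continuousWithinAt.tendsto
      have hev : stepS₂ =ᶠ[nhdsWithin 0 (Iio 0)] fun _ => (0 : ℝ) :=
        eventually_nhdsWithin_of_forall fun y hy => hopen y (Or.inl hy)
      exact tendsto_nhds_unique (htend.congr' hev) tendsto_const_nhds
  · rcases lt_or_eq_of_le hx with h | h
    · exact hopen x (Or.inr h)
    · subst h
      have htend : Filter.Tendsto stepS₂ (nhdsWithin 1 (Ioi 1)) (nhds (stepS₂ 1)) :=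
        continuous_stepS₂.continuousAt.continuousWithinAt.tendsto
      have hev : stepS₂ =ᶠ[nhdsWithin 1 (Ioi 1)] fun _ => (0 : ℝ) :=
        eventually_nhdsWithin_of_forall fun y hy => hopen y (Or.inr hy)
      exact tendsto_nhds_unique (htend.congr' hev) tendsto_const_nhds

/-- A continuous function vanishing off `[0, 1]` is bounded. [folklore] -/
theorem exists_bound_of_vanish {f : ℝ → ℝ} (hf : Continuous f) (h0 : ∀ x, (x ≤ 0 ∨ 1 ≤ x) → f x = 0) :
    ∃ C : ℝ, 1 ≤ C ∧ ∀ x, |f x| ≤ C := by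
  obtain ⟨C, hC⟩ := (isCompact_Icc (a := (0 : ℝ)) (b := 1)).exists_bound_of_continuousOn hf.continuousOn
  refine ⟨max C 1, le_max_right _ _, fun x => ?_⟩
  by_cases hx : x ∈ Icc (0 : ℝ) 1
  · exact ((Real.norm_eq_abs _).symm.le.trans (hC x hx)).trans (le_max_left _ _)
  · rw [Set.mem_Icc, not_and_or, not_le, not_le] at hx
    rw [h0 x (hx.imp le_of_lt le_of_lt), abs_zero]
    exact le_trans zero_le_one (le_max_right _ _)

/-- A bound for `|S'|`. [folklore] -/
theorem exists_bound_stepS₁ : ∃ C : ℝ, 1 ≤ C ∧ ∀ x, |stepS₁ x| ≤ C :=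
  exists_bound_of_vanish continuous_stepS₁ fun _ hx => stepS₁_eq_zero hx

/-- A bound for `|S''|`. [folklore] -/
theorem exists_bound_stepS₂ : ∃ C : ℝ, 1 ≤ C ∧ ∀ x, |stepS₂ x| ≤ C :=
  exists_bound_of_vanish continuous_stepS₂ fun _ hx => stepS₂_eq_zero hx

/-- The constant `C_S ≥ 1` bounding `|S'|` and `|S''|`. [folklore] -/
def stepC : ℝ := max (Classical.choose exists_bound_stepS₁) (Classical.choose exists_bound_stepS₂)

/-- `1 ≤ C_S`. [folklore] -/
theorem one_le_stepC : 1 ≤ stepC :=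
  (Classical.choose_spec exists_bound_stepS₁).1.trans (le_max_left _ _)

/-- `|S'| ≤ C_S`. [folklore] -/
theorem abs_stepS₁_le (x : ℝ) : |stepS₁ x| ≤ stepC :=
  ((Classical.choose_spec exists_bound_stepS₁).2 x).trans (le_max_left _ _)

/-- `|S''| ≤ C_S`. [folklore] -/
theorem abs_stepS₂_le (x : ℝ) : |stepS₂ x| ≤ stepC :=
  ((Classical.choose_spec exists_bound_stepS₂).2 x).trans (le_max_right _ _)

/-- `S` is `C_S`-Lipschitz. [folklore] -/
theorem abs_stepS_sub_le (x y : ℝ) : |stepS x - stepS y| ≤ stepC * |x - y| := by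
  have h := Convex.norm_image_sub_le_of_norm_hasDerivWithin_le (f := stepS) (f' := stepS₁) (s := Set.univ) (C := stepC)
    (fun t _ => (hasDerivAt_stepS t).hasDerivWithinAt) (fun t _ => ?_) convex_univ (Set.mem_univ y) (Set.mem_univ x)
  · simpa [Real.norm_eq_abs] using h
  · rw [Real.norm_eq_abs]; exact abs_stepS₁_le t

/-- `S'` is `C_S`-Lipschitz. [folklore] -/
theorem abs_stepS₁_sub_le (x y : ℝ) : |stepS₁ x - stepS₁ y| ≤ stepC * |x - y| := by
  have h := Convex.norm_image_sub_le_of_norm_hasDerivWithin_le (f := stepS₁) (f' := stepS₂) (s := Set.univ) (C := stepC)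
    (fun t _ => (hasDerivAt_stepS₁ t).hasDerivWithinAt) (fun t _ => ?_) convex_univ (Set.mem_univ y) (Set.mem_univ x)
  · simpa [Real.norm_eq_abs] using h
  · rw [Real.norm_eq_abs]; exact abs_stepS₂_le t

/-! ### The positive-part cube `(y₊)³` -/

/-- `pp3 y = (max y 0)³`. [folklore] -/
def pp3 (y : ℝ) : ℝ := (max y 0) ^ 3

/-- `pp3' y = 3 (max y 0)²`. [folklore] -/
def pp3₁ (y : ℝ) : ℝ := 3 * (max y 0) ^ 2

/-- `pp3'' y = 6 max y 0`. [folklore] -/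
def pp3₂ (y : ℝ) : ℝ := 6 * max y 0

/-- `pp3' ` is the derivative of `pp3`. [folklore] -/
theorem hasDerivAt_pp3 (y : ℝ) : HasDerivAt pp3 (pp3₁ y) y := by
  rcases lt_trichotomy y 0 with hy | hy | hy
  · have hev : pp3 =ᶠ[nhds y] fun _ => (0 : ℝ) := by
      filter_upwards [(isOpen_Iio (a := (0 : ℝ))).mem_nhds hy] with t ht
      simp [pp3, max_eq_right (Set.mem_Iio.1 ht).le]
    rw [show pp3₁ y = 0 by simp [pp3₁, max_eq_right hy.le]]
    exact (hasDerivAt_const y (0 : ℝ)).congr_of_eventuallyEq hev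
  · subst hy
    rw [show pp3₁ 0 = 0 by simp [pp3₁]]
    rw [hasDerivAt_iff_isLittleO]
    simp only [pp3, max_self, sub_zero, smul_zero]
    refine Asymptotics.IsLittleO.of_bound fun c hc => ?_
    have : ∀ᶠ t : ℝ in nhds 0, |t| ≤ 1 ∧ |t| ≤ c := by
      have h1 : ∀ᶠ t : ℝ in nhds 0, |t| < min 1 c := by
        have := Metric.ball_mem_nhds (0 : ℝ) (lt_min one_pos hc)
        filter_upwards [this] with t ht
        simpa [Real.dist_eq] using ht
      filter_upwards [h1] with t ht
      exact ⟨(lt_min_iff.1 ht).1.le, (lt_min_iff.1 ht).2.le⟩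
    filter_upwards [this] with t ht
    have h0 : |max t 0| ≤ |t| := by
      rw [abs_le]; constructor
      · exact le_trans (neg_nonpos.2 (abs_nonneg t)) (le_max_right _ _)
      · exact max_le (le_abs_self t) (abs_nonneg t)
    rw [Real.norm_eq_abs, Real.norm_eq_abs, zero_pow (by norm_num), sub_zero, abs_pow]
    calc |max t 0| ^ 3 ≤ |t| ^ 3 := pow_le_pow_left₀ (abs_nonneg _) h0 3
      _ = |t| * |t| * |t| := by ring
      _ ≤ c * 1 * |t| := by gcongr; exact ht.2; exact ht.1
      _ = c * |t| := by ring
  · have hev : pp3 =ᶠ[nhds y] fun t => t ^ 3 := by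
      filter_upwards [(isOpen_Ioi (a := (0 : ℝ))).mem_nhds hy] with t ht
      simp [pp3, max_eq_left (Set.mem_Ioi.1 ht).le]
    rw [show pp3₁ y = 3 * y ^ 2 by simp [pp3₁, max_eq_left hy.le]]
    have h := (hasDerivAt_pow 3 y)
    refine (h.congr_of_eventuallyEq hev).congr_deriv ?_
    norm_num

/-- `pp3''` is the derivative of `pp3'`. [folklore] -/
theorem hasDerivAt_pp3₁ (y : ℝ) : HasDerivAt pp3₁ (pp3₂ y) y := by
  rcases lt_trichotomy y 0 with hy | hy | hy
  · have hev : pp3₁ =ᶠ[nhds y] fun _ => (0 : ℝ) := by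
      filter_upwards [(isOpen_Iio (a := (0 : ℝ))).mem_nhds hy] with t ht
      simp [pp3₁, max_eq_right (Set.mem_Iio.1 ht).le]
    rw [show pp3₂ y = 0 by simp [pp3₂, max_eq_right hy.le]]
    exact (hasDerivAt_const y (0 : ℝ)).congr_of_eventuallyEq hev
  · subst hy
    rw [show pp3₂ 0 = 0 by simp [pp3₂]]
    rw [hasDerivAt_iff_isLittleO]
    simp only [pp3₁, max_self, sub_zero, smul_zero]
    refine Asymptotics.IsLittleO.of_bound fun c hc => ?_
    have : ∀ᶠ t : ℝ in nhds 0, |t| ≤ c / 3 := by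
      have := Metric.ball_mem_nhds (0 : ℝ) (by positivity : (0 : ℝ) < c / 3)
      filter_upwards [this] with t ht
      have : |t| < c / 3 := by simpa [Real.dist_eq] using ht
      exact this.le
    filter_upwards [this] with t ht
    have h0 : |max t 0| ≤ |t| := by
      rw [abs_le]; constructor
      · exact le_trans (neg_nonpos.2 (abs_nonneg t)) (le_max_right _ _)
      · exact max_le (le_abs_self t) (abs_nonneg t)
    rw [Real.norm_eq_abs, Real.norm_eq_abs, zero_pow (by norm_num), mul_zero, sub_zero, abs_mul, abs_pow,
      show |(3 : ℝ)| = 3 by norm_num]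
    calc 3 * |max t 0| ^ 2 ≤ 3 * |t| ^ 2 := by gcongr
      _ = 3 * |t| * |t| := by ring
      _ ≤ 3 * (c / 3) * |t| := by gcongr
      _ = c * |t| := by ring
  · have hev : pp3₁ =ᶠ[nhds y] fun t => 3 * t ^ 2 := by
      filter_upwards [(isOpen_Ioi (a := (0 : ℝ))).mem_nhds hy] with t ht
      simp [pp3₁, max_eq_left (Set.mem_Ioi.1 ht).le]
    rw [show pp3₂ y = 6 * y by simp [pp3₂, max_eq_left hy.le]]
    have h := (hasDerivAt_pow 2 y).const_mul (3 : ℝ)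
    refine (h.congr_of_eventuallyEq hev).congr_deriv ?_
    norm_num; ring

/-- `pp3''` is continuous. [folklore] -/
theorem continuous_pp3₂ : Continuous pp3₂ := by unfold pp3₂; fun_prop

/-- Sizes on `y ≤ 1`: `0 ≤ pp3 ≤ 1`, `0 ≤ pp3' ≤ 3`, `0 ≤ pp3'' ≤ 6`. [folklore] -/
theorem pp3_bounds {y : ℝ} (hy : y ≤ 1) :
    |pp3 y| ≤ 1 ∧ |pp3₁ y| ≤ 3 ∧ |pp3₂ y| ≤ 6 := by
  have h0 : 0 ≤ max y 0 := le_max_right _ _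
  have h1 : max y 0 ≤ 1 := max_le hy zero_le_one
  have hp : ∀ n : ℕ, max y 0 ^ n ≤ 1 := fun n => pow_le_one₀ h0 h1
  refine ⟨?_, ?_, ?_⟩
  · rw [pp3, abs_of_nonneg (pow_nonneg h0 3)]; exact hp 3
  · rw [pp3₁, abs_of_nonneg (by positivity)]; linarith [hp 2]
  · rw [pp3₂, abs_of_nonneg (by positivity)]; linarith

/-! ### Functions with two bounded derivatives -/

/-- `f` has derivatives `f₁`, `f₂ = f₁'` at every point of `U`, `f₂` is continuous on `U`, and
`|f| ≤ B₀`, `|f₁| ≤ B₁`, `|f₂| ≤ B₂` on `U`. [folklore] -/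
structure C2Bound (U : Set ℝ) (f f₁ f₂ : ℝ → ℝ) (B₀ B₁ B₂ : ℝ) : Prop where
  d1 : ∀ x ∈ U, HasDerivAt f (f₁ x) x
  d2 : ∀ x ∈ U, HasDerivAt f₁ (f₂ x) x
  cont : ContinuousOn f₂ U
  b0 : ∀ x ∈ U, |f x| ≤ B₀
  b1 : ∀ x ∈ U, |f₁ x| ≤ B₁
  b2 : ∀ x ∈ U, |f₂ x| ≤ B₂

/-- First derivative of a product. [folklore] -/
def pmul₁ (f f₁ g g₁ : ℝ → ℝ) (x : ℝ) : ℝ := f₁ x * g x + f x * g₁ x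

/-- Second derivative of a product. [folklore] -/
def pmul₂ (f f₁ f₂ g g₁ g₂ : ℝ → ℝ) (x : ℝ) : ℝ := f₂ x * g x + 2 * (f₁ x * g₁ x) + f x * g₂ x

/-- First derivative of a composition `g ∘ f`. [folklore] -/
def pcomp₁ (f f₁ g₁ : ℝ → ℝ) (x : ℝ) : ℝ := g₁ (f x) * f₁ x

/-- Second derivative of a composition `g ∘ f`. [folklore] -/
def pcomp₂ (f f₁ f₂ g₁ g₂ : ℝ → ℝ) (x : ℝ) : ℝ := g₂ (f x) * f₁ x ^ 2 + g₁ (f x) * f₂ x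

namespace C2Bound

variable {U V : Set ℝ} {f f₁ f₂ g g₁ g₂ : ℝ → ℝ} {B₀ B₁ B₂ C₀ C₁ C₂ : ℝ}

/-- The bounds are nonnegative (if `U` is nonempty). [folklore] -/
theorem nonneg (hf : C2Bound U f f₁ f₂ B₀ B₁ B₂) {x : ℝ} (hx : x ∈ U) : 0 ≤ B₀ ∧ 0 ≤ B₁ ∧ 0 ≤ B₂ :=
  ⟨(abs_nonneg _).trans (hf.b0 x hx), (abs_nonneg _).trans (hf.b1 x hx), (abs_nonneg _).trans (hf.b2 x hx)⟩

/-- Weakening the bounds and shrinking the set. [folklore] -/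
theorem mono (hf : C2Bound U f f₁ f₂ B₀ B₁ B₂) (hV : V ⊆ U) {B₀' B₁' B₂' : ℝ} (h0 : B₀ ≤ B₀') (h1 : B₁ ≤ B₁')
    (h2 : B₂ ≤ B₂') : C2Bound V f f₁ f₂ B₀' B₁' B₂' :=
  ⟨fun x hx => hf.d1 x (hV hx), fun x hx => hf.d2 x (hV hx), hf.cont.mono hV, fun x hx => (hf.b0 x (hV hx)).trans h0,
    fun x hx => (hf.b1 x (hV hx)).trans h1, fun x hx => (hf.b2 x (hV hx)).trans h2⟩

/-- `f` and `f₁` are continuous on `U`. [folklore] -/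
theorem continuousOn (hf : C2Bound U f f₁ f₂ B₀ B₁ B₂) : ContinuousOn f U ∧ ContinuousOn f₁ U :=
  ⟨fun x hx => (hf.d1 x hx).continuousAt.continuousWithinAt, fun x hx => (hf.d2 x hx).continuousAt.continuousWithinAt⟩

/-- **Product rule** with bounds. [folklore] -/
theorem mul (hf : C2Bound U f f₁ f₂ B₀ B₁ B₂) (hg : C2Bound U g g₁ g₂ C₀ C₁ C₂) :
    C2Bound U (fun x => f x * g x) (pmul₁ f f₁ g g₁) (pmul₂ f f₁ f₂ g g₁ g₂) (B₀ * C₀) (B₁ * C₀ + B₀ * C₁)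
      (B₂ * C₀ + 2 * (B₁ * C₁) + B₀ * C₂) := by
  refine ⟨fun x hx => ?_, fun x hx => ?_, ?_, fun x hx => ?_, fun x hx => ?_, fun x hx => ?_⟩
  · have h := (hf.d1 x hx).mul (hg.d1 x hx)
    have e1 : f * g = fun y => f y * g y := by funext y; simp
    rw [e1] at h
    exact h
  · have h := ((hf.d2 x hx).mul (hg.d1 x hx)).add ((hf.d1 x hx).mul (hg.d2 x hx))
    have e1 : f₁ * g + f * g₁ = pmul₁ f f₁ g g₁ := by funext y; simp [pmul₁]
    rw [e1] at h
    refine h.congr_deriv ?_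
    simp only [pmul₂]; ring
  · have hfc := hf.continuousOn; have hgc := hg.continuousOn
    unfold pmul₂
    exact ((hf.cont.mul hgc.1).add (continuousOn_const.mul (hfc.2.mul hgc.2))).add (hfc.1.mul hg.cont)
  · rw [abs_mul]; exact mul_le_mul (hf.b0 x hx) (hg.b0 x hx) (abs_nonneg _) ((hf.nonneg hx).1)
  · have h0 := (hf.nonneg hx); have h0' := (hg.nonneg hx)
    unfold pmul₁
    calc |f₁ x * g x + f x * g₁ x| ≤ |f₁ x| * |g x| + |f x| * |g₁ x| := by
          refine (abs_add_le _ _).trans ?_; rw [abs_mul, abs_mul]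
      _ ≤ B₁ * C₀ + B₀ * C₁ := add_le_add (mul_le_mul (hf.b1 x hx) (hg.b0 x hx) (abs_nonneg _) h0.2.1)
          (mul_le_mul (hf.b0 x hx) (hg.b1 x hx) (abs_nonneg _) h0.1)
  · have h0 := (hf.nonneg hx); have h0' := (hg.nonneg hx)
    unfold pmul₂
    calc |f₂ x * g x + 2 * (f₁ x * g₁ x) + f x * g₂ x|
        ≤ |f₂ x| * |g x| + 2 * (|f₁ x| * |g₁ x|) + |f x| * |g₂ x| := by
          refine (abs_add_le _ _).trans (add_le_add ((abs_add_le _ _).trans (add_le_add ?_ ?_)) ?_)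
          · rw [abs_mul]
          · rw [abs_mul, abs_two, abs_mul]
          · rw [abs_mul]
      _ ≤ B₂ * C₀ + 2 * (B₁ * C₁) + B₀ * C₂ := by
          refine add_le_add (add_le_add ?_ ?_) ?_
          · exact mul_le_mul (hf.b2 x hx) (hg.b0 x hx) (abs_nonneg _) h0.2.2
          · exact mul_le_mul_of_nonneg_left (mul_le_mul (hf.b1 x hx) (hg.b1 x hx) (abs_nonneg _) h0.2.1) (by norm_num)
          · exact mul_le_mul (hf.b0 x hx) (hg.b2 x hx) (abs_nonneg _) h0.1

/-- **Chain rule** with bounds: `g ∘ f` for `f(U) ⊆ V` (the bound `B₀` of `f` is not used). [folklore] -/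
theorem comp (hg : C2Bound V g g₁ g₂ C₀ C₁ C₂) (hf : C2Bound U f f₁ f₂ B₀ B₁ B₂) (hUV : ∀ x ∈ U, f x ∈ V) :
    C2Bound U (fun x => g (f x)) (pcomp₁ f f₁ g₁) (pcomp₂ f f₁ f₂ g₁ g₂) C₀ (C₁ * B₁) (C₂ * B₁ ^ 2 + C₁ * B₂) := by
  refine ⟨fun x hx => ?_, fun x hx => ?_, ?_, fun x hx => hg.b0 _ (hUV x hx), fun x hx => ?_, fun x hx => ?_⟩
  · exact (hg.d1 _ (hUV x hx)).comp x (hf.d1 x hx)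
  · have h1 : HasDerivAt (fun y => g₁ (f y)) (g₂ (f x) * f₁ x) x := (hg.d2 _ (hUV x hx)).comp x (hf.d1 x hx)
    have h := h1.mul (hf.d2 x hx)
    have e1 : (fun y => g₁ (f y)) * f₁ = pcomp₁ f f₁ g₁ := by funext y; simp [pcomp₁]
    rw [e1] at h
    refine h.congr_deriv ?_
    simp only [pcomp₂]; ring
  · have hfc := hf.continuousOn; have hgc := hg.continuousOn
    unfold pcomp₂
    refine ((hg.cont.comp hfc.1 hUV).mul (hfc.2.pow 2)).add ((hgc.2.comp hfc.1 hUV).mul hf.cont)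
  · have h0 := hf.nonneg hx; have h0' := hg.nonneg (hUV x hx)
    unfold pcomp₁; rw [abs_mul]
    exact mul_le_mul (hg.b1 _ (hUV x hx)) (hf.b1 x hx) (abs_nonneg _) h0'.2.1
  · have h0 := hf.nonneg hx; have h0' := hg.nonneg (hUV x hx)
    unfold pcomp₂
    calc |g₂ (f x) * f₁ x ^ 2 + g₁ (f x) * f₂ x| ≤ |g₂ (f x)| * |f₁ x| ^ 2 + |g₁ (f x)| * |f₂ x| := by
          refine (abs_add_le _ _).trans ?_; rw [abs_mul, abs_mul, abs_pow]
      _ ≤ C₂ * B₁ ^ 2 + C₁ * B₂ := add_le_add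
          (mul_le_mul (hg.b2 _ (hUV x hx)) (pow_le_pow_left₀ (abs_nonneg _) (hf.b1 x hx) 2) (by positivity) h0'.2.2)
          (mul_le_mul (hg.b1 _ (hUV x hx)) (hf.b2 x hx) (abs_nonneg _) h0'.2.1)

/-- Difference of two `C2Bound` functions. [folklore] -/
theorem sub (hf : C2Bound U f f₁ f₂ B₀ B₁ B₂) (hg : C2Bound U g g₁ g₂ C₀ C₁ C₂) :
    C2Bound U (fun x => f x - g x) (fun x => f₁ x - g₁ x) (fun x => f₂ x - g₂ x) (B₀ + C₀) (B₁ + C₁) (B₂ + C₂) :=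
  ⟨fun x hx => (hf.d1 x hx).sub (hg.d1 x hx), fun x hx => (hf.d2 x hx).sub (hg.d2 x hx), hf.cont.sub hg.cont,
    fun x hx => (abs_sub _ _).trans (add_le_add (hf.b0 x hx) (hg.b0 x hx)),
    fun x hx => (abs_sub _ _).trans (add_le_add (hf.b1 x hx) (hg.b1 x hx)),
    fun x hx => (abs_sub _ _).trans (add_le_add (hf.b2 x hx) (hg.b2 x hx))⟩

/-- **Mean value**: a `C2Bound` function is `B₁`-Lipschitz on a convex `U`. [folklore] -/
theorem lipschitz (hf : C2Bound U f f₁ f₂ B₀ B₁ B₂) (hU : Convex ℝ U) {x y : ℝ} (hx : x ∈ U) (hy : y ∈ U) :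
    |f x - f y| ≤ B₁ * |x - y| := by
  have h := hU.norm_image_sub_le_of_norm_hasDerivWithin_le (f := f) (f' := f₁) (C := B₁)
    (fun t ht => (hf.d1 t ht).hasDerivWithinAt) (fun t ht => by rw [Real.norm_eq_abs]; exact hf.b1 t ht) hy hx
  simpa [Real.norm_eq_abs] using h

end C2Bound

/-- The smooth step as a `C2Bound` function on `ℝ`. [folklore] -/
theorem c2_stepS : C2Bound Set.univ stepS stepS₁ stepS₂ 1 stepC stepC :=
  ⟨fun x _ => hasDerivAt_stepS x, fun x _ => hasDerivAt_stepS₁ x, continuous_stepS₂.continuousOn,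
    fun x _ => abs_stepS_le x, fun x _ => abs_stepS₁_le x, fun x _ => abs_stepS₂_le x⟩

/-- An affine map `x ↦ αx + β` as a `C2Bound` function, given a bound for its values on `U`. [folklore] -/
theorem c2_affine (α β : ℝ) (U : Set ℝ) {B₀ : ℝ} (hB₀ : ∀ x ∈ U, |α * x + β| ≤ B₀) :
    C2Bound U (fun x => α * x + β) (fun _ => α) (fun _ => 0) B₀ |α| 0 := by
  refine ⟨fun x _ => ?_, fun x _ => hasDerivAt_const x α, continuousOn_const, hB₀, fun x _ => le_rfl,
    fun x _ => by simp⟩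
  simpa using ((hasDerivAt_id x).const_mul α).add_const β

/-! ### The radial factors -/

/-- `ρ^{-1/2}`. [folklore] -/
def rsq (ρ : ℝ) : ℝ := ρ ^ (-(1 / 2 : ℝ))

/-- `(ρ^{-1/2})'`. [folklore] -/
def rsq₁ (ρ : ℝ) : ℝ := -(1 / 2 : ℝ) * ρ ^ (-(1 / 2 : ℝ) - 1)

/-- `(ρ^{-1/2})''`. [folklore] -/
def rsq₂ (ρ : ℝ) : ℝ := -(1 / 2 : ℝ) * ((-(1 / 2 : ℝ) - 1) * ρ ^ (-(1 / 2 : ℝ) - 1 - 1))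

/-- `ρ^{-1/2}` on `(m, ∞)`, `m > 0`: bounds `m^{-1/2}`, `m^{-3/2}/2`, `(3/4) m^{-5/2}`. [folklore] -/
theorem c2_rsq {m : ℝ} (hm : 0 < m) :
    C2Bound (Ioi m) rsq rsq₁ rsq₂ (m ^ (-(1 / 2 : ℝ))) ((1 / 2) * m ^ (-(3 / 2 : ℝ))) ((3 / 4) * m ^ (-(5 / 2 : ℝ))) := by
  have hpow : ∀ (x : ℝ), x ∈ Ioi m → ∀ p : ℝ, p ≤ 0 → x ^ p ≤ m ^ p := fun x hx p hp =>
    Real.rpow_le_rpow_of_nonpos hm (le_of_lt hx) hp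
  refine ⟨fun x hx => ?_, fun x hx => ?_, ?_, fun x hx => ?_, fun x hx => ?_, fun x hx => ?_⟩
  · exact Real.hasDerivAt_rpow_const (Or.inl (hm.trans hx).ne')
  · exact (Real.hasDerivAt_rpow_const (Or.inl (hm.trans hx).ne')).const_mul _
  · unfold rsq₂
    refine ContinuousOn.mul continuousOn_const (ContinuousOn.mul continuousOn_const ?_)
    exact ContinuousOn.rpow_const continuousOn_id fun x hx => Or.inl (hm.trans hx).ne'
  · rw [rsq, abs_of_nonneg (Real.rpow_nonneg (hm.trans hx).le _)]
    exact hpow x hx _ (by norm_num)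
  · have hx0 : 0 < x := hm.trans hx
    rw [rsq₁, abs_mul, abs_neg, abs_of_nonneg (by norm_num : (0 : ℝ) ≤ 1 / 2),
      abs_of_nonneg (Real.rpow_nonneg hx0.le _), show (-(1 / 2 : ℝ) - 1) = -(3 / 2 : ℝ) by norm_num]
    exact mul_le_mul_of_nonneg_left (hpow x hx _ (by norm_num)) (by norm_num)
  · have hx0 : 0 < x := hm.trans hx
    rw [rsq₂, show (-(1 / 2 : ℝ) - 1 - 1) = -(5 / 2 : ℝ) by norm_num,
      show -(1 / 2 : ℝ) * ((-(1 / 2 : ℝ) - 1) * x ^ (-(5 / 2 : ℝ))) = (3 / 4) * x ^ (-(5 / 2 : ℝ)) by ring,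
      abs_of_nonneg (by positivity)]
    exact mul_le_mul_of_nonneg_left (hpow x hx _ (by norm_num)) (by norm_num)


/-- `x^{-1/2} ≤ 2/R` for `x ≥ R²/4`. [folklore] -/
theorem rpow_neg_half_le {R x : ℝ} (hR : 0 < R) (hx : R ^ 2 / 4 ≤ x) : x ^ (-(1 / 2 : ℝ)) ≤ 2 / R := by
  have hx0 : 0 < x := lt_of_lt_of_le (by positivity) hx
  rw [Real.rpow_neg hx0.le, ← Real.sqrt_eq_rpow]
  have h1 : R / 2 ≤ Real.sqrt x := by
    rw [Real.le_sqrt (by positivity) hx0.le]; nlinarith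
  calc (Real.sqrt x)⁻¹ ≤ (R / 2)⁻¹ := inv_anti₀ (by positivity) h1
    _ = 2 / R := by rw [inv_div]

/-- `ρ^{-1/2}` on `(R²/2, ∞)`: bounds `2/R`, `2/R³`, `6/R⁵`. [folklore] -/
theorem c2_rsq' {R : ℝ} (hR : 0 < R) :
    C2Bound (Ioi (R ^ 2 / 2)) rsq rsq₁ rsq₂ (2 / R) (2 / R ^ 3) (6 / R ^ 5) := by
  have hm : 0 < R ^ 2 / 2 := by positivity
  have h2 : (R ^ 2 / 2) ^ (-(1 / 2 : ℝ)) ≤ 2 / R := rpow_neg_half_le hR (by nlinarith)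
  refine (c2_rsq hm).mono subset_rfl h2 ?_ ?_
  · have h1 : (R ^ 2 / 2) ^ (-(3 / 2 : ℝ)) = (R ^ 2 / 2) ^ (-(1 / 2 : ℝ)) / (R ^ 2 / 2) := by
      rw [show (-(3 / 2 : ℝ)) = -(1 / 2 : ℝ) - 1 by norm_num, Real.rpow_sub_one hm.ne']
    rw [h1]
    calc 1 / 2 * ((R ^ 2 / 2) ^ (-(1 / 2 : ℝ)) / (R ^ 2 / 2)) ≤ 1 / 2 * ((2 / R) / (R ^ 2 / 2)) := by gcongr
      _ = 2 / R ^ 3 := by field_simp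
  · have h1 : (R ^ 2 / 2) ^ (-(5 / 2 : ℝ)) = (R ^ 2 / 2) ^ (-(1 / 2 : ℝ)) / (R ^ 2 / 2) / (R ^ 2 / 2) := by
      rw [show (-(5 / 2 : ℝ)) = -(1 / 2 : ℝ) - 1 - 1 by norm_num, Real.rpow_sub_one hm.ne', Real.rpow_sub_one hm.ne']
    rw [h1]
    calc 3 / 4 * ((R ^ 2 / 2) ^ (-(1 / 2 : ℝ)) / (R ^ 2 / 2) / (R ^ 2 / 2))
        ≤ 3 / 4 * ((2 / R) / (R ^ 2 / 2) / (R ^ 2 / 2)) := by gcongr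
      _ = 6 / R ^ 5 := by field_simp; ring

/-- The Riesz factor `(1 - ρ/x)₊³`. [folklore] -/
def rz (x ρ : ℝ) : ℝ := pp3 (-(1 / x) * ρ + 1)

/-- `rz'`. [folklore] -/
def rz₁ (x : ℝ) : ℝ → ℝ := pcomp₁ (fun ρ => -(1 / x) * ρ + 1) (fun _ => -(1 / x)) pp3₁

/-- `rz''`. [folklore] -/
def rz₂ (x : ℝ) : ℝ → ℝ := pcomp₂ (fun ρ => -(1 / x) * ρ + 1) (fun _ => -(1 / x)) (fun _ => 0) pp3₁ pp3₂

/-- `(1 - ρ/x)₊³` on `(0, L)` (`x > 0`): bounds `1`, `3/x`, `6/x²`. [folklore] -/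
theorem c2_rz {x L : ℝ} (hx : 0 < x) :
    C2Bound (Ioo 0 L) (rz x) (rz₁ x) (rz₂ x) 1 (3 / x) (6 / x ^ 2) := by
  have hpp : C2Bound (Iic 1) pp3 pp3₁ pp3₂ 1 3 6 :=
    ⟨fun y _ => hasDerivAt_pp3 y, fun y _ => hasDerivAt_pp3₁ y, continuous_pp3₂.continuousOn,
      fun y hy => (pp3_bounds hy).1, fun y hy => (pp3_bounds hy).2.1, fun y hy => (pp3_bounds hy).2.2⟩
  have haff : C2Bound (Ioo (0 : ℝ) L) (fun ρ => -(1 / x) * ρ + 1) (fun _ => -(1 / x)) (fun _ => 0) (1 + L / x)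
      |-(1 / x)| 0 :=
    c2_affine (-(1 / x)) 1 (Ioo (0 : ℝ) L) fun ρ hρ => by
      obtain ⟨hρ0, hρL⟩ := hρ
      have hL : 0 ≤ L := (hρ0.trans hρL).le
      have h1 : 0 ≤ 1 / x * ρ := by positivity
      have h2 : 1 / x * ρ ≤ L / x := by rw [div_mul_eq_mul_div, one_mul]; exact div_le_div_of_nonneg_right hρL.le hx.le
      have h3 : 0 ≤ L / x := div_nonneg hL hx.le
      rw [abs_le]; constructor <;> nlinarith
  have h := hpp.comp haff (fun ρ hρ => by
    have : 0 ≤ 1 / x * ρ := by have := hρ.1; positivity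
    show -(1 / x) * ρ + 1 ∈ Iic 1
    simp only [Set.mem_Iic]; linarith)
  refine h.mono subset_rfl le_rfl ?_ ?_
  · rw [abs_neg, abs_of_pos (by positivity)]; exact le_of_eq (by ring)
  · rw [abs_neg, abs_of_pos (by positivity)]; exact le_of_eq (by ring)

/-- The dyadic window `χ_R(ρ) = S(ρ/(2R²) - 1) - S(ρ/(4R²) - 1)`, supported in `2R² ≤ ρ ≤ 8R²`. [folklore] -/
def dyadWin (R ρ : ℝ) : ℝ := stepS (1 / (2 * R ^ 2) * ρ + -1) - stepS (1 / (4 * R ^ 2) * ρ + -1)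

/-- `χ_R'`. [folklore] -/
def dyadWin₁ (R : ℝ) : ℝ → ℝ := fun ρ =>
  pcomp₁ (fun ρ => 1 / (2 * R ^ 2) * ρ + -1) (fun _ => 1 / (2 * R ^ 2)) stepS₁ ρ
    - pcomp₁ (fun ρ => 1 / (4 * R ^ 2) * ρ + -1) (fun _ => 1 / (4 * R ^ 2)) stepS₁ ρ

/-- `χ_R''`. [folklore] -/
def dyadWin₂ (R : ℝ) : ℝ → ℝ := fun ρ =>
  pcomp₂ (fun ρ => 1 / (2 * R ^ 2) * ρ + -1) (fun _ => 1 / (2 * R ^ 2)) (fun _ => 0) stepS₁ stepS₂ ρ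
    - pcomp₂ (fun ρ => 1 / (4 * R ^ 2) * ρ + -1) (fun _ => 1 / (4 * R ^ 2)) (fun _ => 0) stepS₁ stepS₂ ρ

/-- The dyadic window on `(0, L)`: bounds `2`, `C_S/R²`, `C_S/R⁴`. [folklore] -/
theorem c2_dyadWin {R L : ℝ} (hR : 0 < R) :
    C2Bound (Ioo 0 L) (dyadWin R) (dyadWin₁ R) (dyadWin₂ R) 2 (stepC / R ^ 2) (stepC / R ^ 4) := by
  have hC := one_le_stepC
  have haff : ∀ k : ℝ, 0 < k → C2Bound (Ioo (0 : ℝ) L) (fun ρ => 1 / k * ρ + -1) (fun _ => 1 / k) (fun _ => 0)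
      (1 + L / k) |1 / k| 0 := fun k hk =>
    c2_affine (1 / k) (-1) (Ioo (0 : ℝ) L) fun ρ hρ => by
      obtain ⟨hρ0, hρL⟩ := hρ
      have hL : 0 ≤ L := (hρ0.trans hρL).le
      have h1 : 0 ≤ 1 / k * ρ := by positivity
      have h2 : 1 / k * ρ ≤ L / k := by rw [div_mul_eq_mul_div, one_mul]; exact div_le_div_of_nonneg_right hρL.le hk.le
      have h3 : 0 ≤ L / k := div_nonneg hL hk.le
      rw [abs_le]; constructor <;> nlinarith
  have h2 := c2_stepS.comp (haff (2 * R ^ 2) (by positivity)) (fun _ _ => Set.mem_univ _)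
  have h4 := c2_stepS.comp (haff (4 * R ^ 2) (by positivity)) (fun _ _ => Set.mem_univ _)
  have h := h2.sub h4
  refine h.mono subset_rfl (by norm_num) ?_ ?_
  · rw [abs_of_pos (by positivity), abs_of_pos (by positivity)]
    have hR2 : 0 < R ^ 2 := pow_pos hR 2
    have e1 : stepC * (1 / (2 * R ^ 2)) = (1 / 2) * (stepC / R ^ 2) := by field_simp
    have e2 : stepC * (1 / (4 * R ^ 2)) = (1 / 4) * (stepC / R ^ 2) := by field_simp
    have h0 : 0 ≤ stepC / R ^ 2 := by positivity
    linarith [e1, e2, h0]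
  · rw [abs_of_pos (by positivity), abs_of_pos (by positivity)]
    have hR4 : 0 < R ^ 4 := pow_pos hR 4
    have e1 : stepC * (1 / (2 * R ^ 2)) ^ 2 = (1 / 4) * (stepC / R ^ 4) := by field_simp; ring
    have e2 : stepC * (1 / (4 * R ^ 2)) ^ 2 = (1 / 16) * (stepC / R ^ 4) := by field_simp; ring
    have h0 : 0 ≤ stepC / R ^ 4 := by positivity
    linarith [e1, e2, h0]

/-- The dyadic window vanishes off `(2R², 8R²)`. [folklore] -/
theorem dyadWin_eq_zero {R ρ : ℝ} (hR : 0 < R) (h : ρ ≤ 2 * R ^ 2 ∨ 8 * R ^ 2 ≤ ρ) : dyadWin R ρ = 0 := by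
  have hR2 : 0 < R ^ 2 := pow_pos hR 2
  unfold dyadWin
  have e1 : 1 / (2 * R ^ 2) * ρ = ρ / (2 * R ^ 2) := by ring
  have e2 : 1 / (4 * R ^ 2) * ρ = ρ / (4 * R ^ 2) := by ring
  rcases h with h | h
  · have h1 : ρ / (2 * R ^ 2) ≤ 1 := by rw [div_le_one (by positivity)]; linarith
    have h2 : ρ / (4 * R ^ 2) ≤ 1 := by rw [div_le_one (by positivity)]; linarith
    rw [stepS_of_nonpos (by rw [e1]; linarith), stepS_of_nonpos (by rw [e2]; linarith), sub_zero]
  · have h1 : 2 ≤ ρ / (2 * R ^ 2) := by rw [le_div_iff₀ (by positivity)]; linarith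
    have h2 : 2 ≤ ρ / (4 * R ^ 2) := by rw [le_div_iff₀ (by positivity)]; linarith
    rw [stepS_of_one_le (by rw [e1]; linarith), stepS_of_one_le (by rw [e2]; linarith), sub_self]

/-- `|χ_R| ≤ 1` (difference of two numbers in `[0,1]` in the right order is not needed). [folklore] -/
theorem abs_dyadWin_le (R ρ : ℝ) : |dyadWin R ρ| ≤ 1 := by
  unfold dyadWin
  have h1 := stepS_mem (1 / (2 * R ^ 2) * ρ + -1)
  have h2 := stepS_mem (1 / (4 * R ^ 2) * ρ + -1)
  rw [abs_le]; constructor <;> linarith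

/-- **The radial profile** `g₀(ρ) = ρ^{-1/2} (1 - ρ/x)₊³ χ_R(ρ)`. [folklore] -/
def radProf (x R ρ : ℝ) : ℝ := rsq ρ * rz x ρ * dyadWin R ρ

/-- `g₀'`. [folklore] -/
def radProf₁ (x R : ℝ) : ℝ → ℝ :=
  pmul₁ (fun ρ => rsq ρ * rz x ρ) (pmul₁ rsq rsq₁ (rz x) (rz₁ x)) (dyadWin R) (dyadWin₁ R)

/-- `g₀''`. [folklore] -/
def radProf₂ (x R : ℝ) : ℝ → ℝ :=
  pmul₂ (fun ρ => rsq ρ * rz x ρ) (pmul₁ rsq rsq₁ (rz x) (rz₁ x)) (pmul₂ rsq rsq₁ rsq₂ (rz x) (rz₁ x) (rz₂ x))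
    (dyadWin R) (dyadWin₁ R) (dyadWin₂ R)

/-- The domain `(R²/2, 25R²)` of the radial variable `ρ = |z|²`. [folklore] -/
def radDom (R : ℝ) : Set ℝ := Ioo (R ^ 2 / 2) (25 * R ^ 2)

/-- **The radial profile has two bounded derivatives**: on `(R²/2, 25R²)`, for `R > 0`, `R² ≤ x`,
`|g₀| ≤ 4/R`, `|g₀'| ≤ 18 C_S/R³`, `|g₀''| ≤ 78 C_S/R⁵`. [folklore] -/
theorem c2_radProf {x R : ℝ} (hR : 0 < R) (hx : R ^ 2 ≤ x) :
    C2Bound (radDom R) (radProf x R) (radProf₁ x R) (radProf₂ x R) (4 / R) (18 * stepC / R ^ 3) (78 * stepC / R ^ 5) := by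
  have hC := one_le_stepC
  have hx0 : 0 < x := lt_of_lt_of_le (pow_pos hR 2) hx
  have hsub1 : radDom R ⊆ Ioi (R ^ 2 / 2) := fun ρ hρ => hρ.1
  have hsub2 : radDom R ⊆ Ioo 0 (25 * R ^ 2) := fun ρ hρ => ⟨lt_trans (by positivity) hρ.1, hρ.2⟩
  have h1 := (c2_rsq' hR).mono hsub1 le_rfl le_rfl le_rfl
  have h2 := (c2_rz hx0 (L := 25 * R ^ 2)).mono hsub2 le_rfl le_rfl le_rfl
  have h3 := (c2_dyadWin hR (L := 25 * R ^ 2)).mono hsub2 le_rfl le_rfl le_rfl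
  have h12 := h1.mul h2
  have h := h12.mul h3
  -- simplify the bounds
  have hR1 : 0 < R := hR
  have i1 : 3 / x ≤ 3 / R ^ 2 := div_le_div_of_nonneg_left (by norm_num) (pow_pos hR 2) hx
  have i2 : 6 / x ^ 2 ≤ 6 / R ^ 4 := by
    refine div_le_div_of_nonneg_left (by norm_num) (by positivity) ?_
    calc R ^ 4 = (R ^ 2) ^ 2 := by ring
      _ ≤ x ^ 2 := pow_le_pow_left₀ (by positivity) hx 2
  refine h.mono subset_rfl (le_of_eq (by ring)) ?_ ?_
  · -- first derivative: (2/R³·1 + 2/R·(3/x))·2 + (2/R·1)·(C/R²) ≤ 18C/R³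
    have e : (2 / R ^ 3 * 1 + 2 / R * (3 / x)) * 2 + 2 / R * 1 * (stepC / R ^ 2)
        ≤ (2 / R ^ 3 * 1 + 2 / R * (3 / R ^ 2)) * 2 + 2 / R * 1 * (stepC / R ^ 2) := by gcongr
    refine e.trans ?_
    rw [show (2 / R ^ 3 * 1 + 2 / R * (3 / R ^ 2)) * 2 + 2 / R * 1 * (stepC / R ^ 2) = (16 + 2 * stepC) / R ^ 3 by
      field_simp; ring]
    exact div_le_div_of_nonneg_right (by nlinarith) (by positivity)
  · -- second derivative
    have e : (6 / R ^ 5 * 1 + 2 * (2 / R ^ 3 * (3 / x)) + 2 / R * (6 / x ^ 2)) * 2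
          + 2 * ((2 / R ^ 3 * 1 + 2 / R * (3 / x)) * (stepC / R ^ 2)) + 2 / R * 1 * (stepC / R ^ 4)
        ≤ (6 / R ^ 5 * 1 + 2 * (2 / R ^ 3 * (3 / R ^ 2)) + 2 / R * (6 / R ^ 4)) * 2
          + 2 * ((2 / R ^ 3 * 1 + 2 / R * (3 / R ^ 2)) * (stepC / R ^ 2)) + 2 / R * 1 * (stepC / R ^ 4) := by
      gcongr
    refine e.trans ?_
    rw [show (6 / R ^ 5 * 1 + 2 * (2 / R ^ 3 * (3 / R ^ 2)) + 2 / R * (6 / R ^ 4)) * 2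
          + 2 * ((2 / R ^ 3 * 1 + 2 / R * (3 / R ^ 2)) * (stepC / R ^ 2)) + 2 / R * 1 * (stepC / R ^ 4)
        = (60 + 18 * stepC) / R ^ 5 by field_simp; ring]
    exact div_le_div_of_nonneg_right (by nlinarith) (by positivity)

/-- The radial profile vanishes off `(2R², 8R²)`. [folklore] -/
theorem radProf_eq_zero {x R ρ : ℝ} (hR : 0 < R) (h : ρ ≤ 2 * R ^ 2 ∨ 8 * R ^ 2 ≤ ρ) : radProf x R ρ = 0 := by
  rw [radProf, dyadWin_eq_zero hR h, mul_zero]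

/-! ### The angular factor -/

/-- The angular bump `β(y) = S(cos(24y) + 1/2)` (`= 1` for `|y| ≤ π/36`... up to the period `π/12`; vanishes where
`cos(24y) ≤ -1/2`). [folklore] -/
def angB (y : ℝ) : ℝ := stepS (Real.cos (24 * y) + 1 / 2)

/-- `β'`. [folklore] -/
def angB₁ : ℝ → ℝ := pcomp₁ (fun y => Real.cos (24 * y) + 1 / 2) (fun y => -(24 * Real.sin (24 * y))) stepS₁

/-- `β''`. [folklore] -/
def angB₂ : ℝ → ℝ :=
  pcomp₂ (fun y => Real.cos (24 * y) + 1 / 2) (fun y => -(24 * Real.sin (24 * y))) (fun y => -(576 * Real.cos (24 * y)))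
    stepS₁ stepS₂

/-- `y ↦ cos(24y) + 1/2` with two derivatives: bounds `3/2`, `24`, `576`. [folklore] -/
theorem c2_cos24 : C2Bound Set.univ (fun y => Real.cos (24 * y) + 1 / 2) (fun y => -(24 * Real.sin (24 * y)))
    (fun y => -(576 * Real.cos (24 * y))) (3 / 2) 24 576 := by
  refine ⟨fun y _ => ?_, fun y _ => ?_, by fun_prop, fun y _ => ?_, fun y _ => ?_, fun y _ => ?_⟩
  · have h := ((Real.hasDerivAt_cos (24 * y)).comp y ((hasDerivAt_id y).const_mul 24)).add_const (1 / 2)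
    refine h.congr_deriv ?_; simp; ring
  · have h := ((Real.hasDerivAt_sin (24 * y)).comp y ((hasDerivAt_id y).const_mul 24)).const_mul 24 |>.neg
    refine h.congr_deriv ?_; simp; ring
  · have := Real.abs_cos_le_one (24 * y)
    rw [abs_le] at this ⊢; constructor <;> linarith [this.1, this.2]
  · rw [abs_neg, abs_mul, show |(24 : ℝ)| = 24 by norm_num]
    nlinarith [Real.abs_sin_le_one (24 * y)]
  · rw [abs_neg, abs_mul, show |(576 : ℝ)| = 576 by norm_num]
    nlinarith [Real.abs_cos_le_one (24 * y)]

/-- The angular bump with two derivatives: bounds `1`, `24 C_S`, `1152 C_S`. [folklore] -/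
theorem c2_angB : C2Bound Set.univ angB angB₁ angB₂ 1 (24 * stepC) (1152 * stepC) := by
  have h := c2_stepS.comp c2_cos24 (fun _ _ => Set.mem_univ _)
  refine h.mono subset_rfl le_rfl (by linarith) (by nlinarith [one_le_stepC])

/-- `β = 0` where `cos(24y) ≤ -1/2`. [folklore] -/
theorem angB_eq_zero {y : ℝ} (h : Real.cos (24 * y) ≤ -(1 / 2)) : angB y = 0 :=
  stepS_of_nonpos (by linarith)

/-- `|β| ≤ 1`, `0 ≤ β`. [folklore] -/
theorem angB_mem (y : ℝ) : 0 ≤ angB y ∧ angB y ≤ 1 := stepS_mem _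

/-- The angular coordinate `A_u(z) = arg(z ū) = Im log(z ū)` (as the imaginary part of `logPhase (2π) u`). [folklore] -/
def angA (u z : ℂ) : ℝ := (logPhase (2 * π) u z).im

/-- `logPhase (2π) u z = log(z ū)`. [folklore] -/
theorem logPhase_two_pi (u z : ℂ) : logPhase (2 * π) u z = Complex.log (z * (starRingEnd ℂ) u) := by
  have hπ : (2 * (π : ℂ)) ≠ 0 := by simp [Real.pi_ne_zero]
  rw [logPhase]; rw [div_self hπ, one_mul]

/-- `‖(2π : ℂ)‖/(2π) = 1`. [folklore] -/
theorem norm_two_pi_div : ‖(2 * (π : ℂ))‖ / (2 * π) = 1 := by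
  rw [norm_mul, Complex.norm_two, Complex.norm_real, Real.norm_eq_abs, abs_of_pos Real.pi_pos,
    div_self (by positivity)]

/-- Sizes of the derivatives of `log(z ū)`: `‖G₁‖ = 1/‖z‖ ≤ 1/R₀`, `‖G₂‖ ≤ 1/R₀²` for `‖z‖ ≥ R₀ > 0`. [folklore] -/
theorem norm_logDeriv_le {R₀ : ℝ} (hR₀ : 0 < R₀) {z : ℂ} (hz : R₀ ≤ ‖z‖) :
    ‖logPhase₁ (2 * π) z‖ ≤ 1 / R₀ ∧ ‖logPhase₂ (2 * π) z‖ ≤ 1 / R₀ ^ 2 := by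
  have hz0 : 0 < ‖z‖ := hR₀.trans_le hz
  have hc : ‖(2 * (π : ℂ)) / (2 * π)‖ = 1 := by rw [norm_coef]; exact norm_two_pi_div
  constructor
  · rw [logPhase₁, norm_mul, hc, one_mul, norm_zpow, zpow_neg, zpow_one]
    exact (inv_anti₀ hR₀ hz).trans_eq (one_div R₀).symm
  · rw [logPhase₂, norm_mul, norm_neg, hc, one_mul, norm_zpow, zpow_neg, zpow_ofNat, one_div]
    exact inv_anti₀ (pow_pos hR₀ 2) (pow_le_pow_left₀ hR₀.le hz 2)


/-! ### Derivatives along affine lines `a ↦ a d + b` -/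

/-- The affine line `a ↦ a d + b` has derivative `d`. [folklore] -/
theorem hasDerivAt_affine (d b : ℂ) (a : ℝ) : HasDerivAt (fun a : ℝ => (a : ℂ) * d + b) d a := by
  have h1 : HasDerivAt (fun a : ℝ => (a : ℂ)) 1 a := Complex.ofRealCLM.hasDerivAt
  simpa using (h1.mul_const d).add_const b

/-- Chain rule along an affine line for the imaginary part: if `K' = K₁` at `ad + b` then
`a ↦ Im(K(ad + b) q)` has derivative `Im(K₁(ad + b) d q)`. [folklore] -/
theorem hasDerivAt_im_affine {K K₁ : ℂ → ℂ} {d b : ℂ} {a : ℝ} (q : ℂ)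
    (hK : HasDerivAt K (K₁ ((a : ℂ) * d + b)) ((a : ℂ) * d + b)) :
    HasDerivAt (fun a : ℝ => (K ((a : ℂ) * d + b) * q).im) ((K₁ ((a : ℂ) * d + b) * d * q).im) a := by
  have hcomp := (hK.comp a (hasDerivAt_affine d b a)).mul_const q
  have him := Complex.imCLM.hasFDerivAt.comp_hasDerivAt a hcomp
  simpa [Function.comp_def] using him

/-- Transport of `C2Bound` along equalities of the three functions. [folklore] -/
theorem C2Bound.congr {U : Set ℝ} {f f₁ f₂ f' f₁' f₂' : ℝ → ℝ} {B₀ B₁ B₂ : ℝ} (h : C2Bound U f f₁ f₂ B₀ B₁ B₂)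
    (hf : f = f') (h1 : f₁ = f₁') (h2 : f₂ = f₂') : C2Bound U f' f₁' f₂' B₀ B₁ B₂ := by
  subst hf h1 h2; exact h

/-- `d/da ‖z(a)‖² = 2 Re(z d̄)`. [folklore] -/
def qd (d z : ℂ) : ℝ := 2 * (z * (starRingEnd ℂ) d).re

/-- `d/da A_u(z(a)) = Im(z⁻¹ d)` (as `Im(G₁ d)` with `G = log(· ū)`). [folklore] -/
def angAd (d z : ℂ) : ℝ := (logPhase₁ (2 * π) z * d).im

/-- `d²/da² A_u(z(a)) = Im(-z⁻² d²)`. [folklore] -/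
def angAdd (d z : ℂ) : ℝ := (logPhase₂ (2 * π) z * d ^ 2).im

/-- `|2 Re(z d̄)| ≤ 2‖z‖‖d‖`. [folklore] -/
theorem abs_qd_le (d z : ℂ) : |qd d z| ≤ 2 * ‖z‖ * ‖d‖ := by
  rw [qd, abs_mul, abs_two, mul_assoc]
  refine mul_le_mul_of_nonneg_left ((Complex.abs_re_le_norm _).trans ?_) (by norm_num)
  rw [norm_mul, Complex.norm_conj]

/-- `‖z‖ < 5R` when `‖z‖² ∈ radDom R`. [folklore] -/
theorem norm_lt_of_radDom {R : ℝ} (hR : 0 < R) {z : ℂ} (hz : ‖z‖ ^ 2 ∈ radDom R) : ‖z‖ < 5 * R ∧ R / 2 < ‖z‖ := by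
  constructor
  · refine lt_of_pow_lt_pow_left₀ 2 (by positivity) ?_
    have := hz.2; nlinarith
  · refine lt_of_pow_lt_pow_left₀ 2 (norm_nonneg _) ?_
    have := hz.1; nlinarith

/-- `‖ad + b‖²` along the line, with two derivatives: on `{a : ‖ad+b‖² ∈ radDom R}` the bounds are
`25R²`, `10R‖d‖`, `2‖d‖²`. [folklore] -/
theorem c2_normSq_line (d b : ℂ) {R : ℝ} (hR : 0 < R) :
    C2Bound {a : ℝ | ‖(a : ℂ) * d + b‖ ^ 2 ∈ radDom R} (fun a : ℝ => ‖(a : ℂ) * d + b‖ ^ 2)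
      (fun a => qd d ((a : ℂ) * d + b)) (fun _ => 2 * ‖d‖ ^ 2) (25 * R ^ 2) (10 * R * ‖d‖) (2 * ‖d‖ ^ 2) := by
  have hre : ∀ a : ℝ, ((a : ℂ) * d + b).re = a * d.re + b.re := fun a => by simp
  have him : ∀ a : ℝ, ((a : ℂ) * d + b).im = a * d.im + b.im := fun a => by simp
  have hsq : (fun a : ℝ => ‖(a : ℂ) * d + b‖ ^ 2) = fun a => (a * d.re + b.re) ^ 2 + (a * d.im + b.im) ^ 2 := by
    funext a; rw [Complex.sq_norm, Complex.normSq_apply, hre, him]; ring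
  have hqd : ∀ a : ℝ, qd d ((a : ℂ) * d + b) = 2 * ((a * d.re + b.re) * d.re + (a * d.im + b.im) * d.im) := by
    intro a; rw [qd, Complex.mul_re, Complex.conj_re, Complex.conj_im, hre, him]; ring
  have hqd' : (fun a : ℝ => qd d ((a : ℂ) * d + b)) = fun a => 2 * ((a * d.re + b.re) * d.re + (a * d.im + b.im) * d.im) :=
    funext hqd
  have hl1 : ∀ a : ℝ, HasDerivAt (fun a : ℝ => a * d.re + b.re) d.re a := fun a => by
    simpa using ((hasDerivAt_id a).mul_const d.re).add_const b.re
  have hl2 : ∀ a : ℝ, HasDerivAt (fun a : ℝ => a * d.im + b.im) d.im a := fun a => by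
    simpa using ((hasDerivAt_id a).mul_const d.im).add_const b.im
  refine ⟨fun a _ => ?_, fun a _ => ?_, continuousOn_const, fun a ha => ?_, fun a ha => ?_, fun a _ => ?_⟩
  · rw [hsq, hqd]
    have h := ((hl1 a).pow 2).add ((hl2 a).pow 2)
    refine h.congr_deriv ?_
    push_cast; ring
  · rw [hqd']
    have h := (((hl1 a).mul_const d.re).add ((hl2 a).mul_const d.im)).const_mul 2
    refine h.congr_deriv ?_
    have hd2 : ‖d‖ ^ 2 = d.re * d.re + d.im * d.im := by rw [Complex.sq_norm, Complex.normSq_apply]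
    rw [hd2]
  · rw [abs_of_nonneg (by positivity)]; exact ha.2.le
  · have hz := (norm_lt_of_radDom hR ha).1
    refine (abs_qd_le d _).trans ?_
    have := norm_nonneg d
    nlinarith
  · rw [abs_of_nonneg (by positivity)]

/-- `|A_u| ≤ π`. [folklore] -/
theorem abs_angA_le (u z : ℂ) : |angA u z| ≤ π := by
  rw [angA, logPhase_two_pi, abs_le]
  exact ⟨(Complex.neg_pi_lt_log_im _).le, Complex.log_im_le_pi _⟩

/-- The angular coordinate along a line, with two derivatives: on `{a : ad + b ∈ halfPlane u, ‖ad+b‖² ∈ radDom R}`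
the bounds are `π`, `2‖d‖/R`, `4‖d‖²/R²`. [folklore] -/
theorem c2_angA_line (u d b : ℂ) {R : ℝ} (hR : 0 < R) :
    C2Bound {a : ℝ | (a : ℂ) * d + b ∈ halfPlane u ∧ ‖(a : ℂ) * d + b‖ ^ 2 ∈ radDom R}
      (fun a : ℝ => angA u ((a : ℂ) * d + b)) (fun a => angAd d ((a : ℂ) * d + b)) (fun a => angAdd d ((a : ℂ) * d + b))
      π (2 * ‖d‖ / R) (4 * ‖d‖ ^ 2 / R ^ 2) := by
  have HC := logPhase_holChain (2 * π) u
  have hsz : ∀ a : ℝ, (a : ℂ) * d + b ∈ halfPlane u ∧ ‖(a : ℂ) * d + b‖ ^ 2 ∈ radDom R →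
      ‖logPhase₁ (2 * π) ((a : ℂ) * d + b)‖ ≤ 1 / (R / 2) ∧ ‖logPhase₂ (2 * π) ((a : ℂ) * d + b)‖ ≤ 1 / (R / 2) ^ 2 :=
    fun a ha => norm_logDeriv_le (by positivity) (norm_lt_of_radDom hR ha.2).2.le
  refine ⟨fun a ha => ?_, fun a ha => ?_, fun a ha => ?_, fun a _ => abs_angA_le u _, fun a ha => ?_, fun a ha => ?_⟩
  · have h := hasDerivAt_im_affine (K := logPhase (2 * π) u) (b := b) (d := d) (a := a) 1 (HC.d1 _ ha.1)
    simp only [mul_one] at h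
    exact h
  · have h := hasDerivAt_im_affine (K := logPhase₁ (2 * π)) (b := b) (d := d) (a := a) d (HC.d2 _ ha.1)
    refine h.congr_deriv ?_
    rw [angAdd]; ring_nf
  · have h := hasDerivAt_im_affine (K := logPhase₂ (2 * π)) (b := b) (d := d) (a := a) (d ^ 2) (HC.d3 _ ha.1)
    exact h.continuousAt.continuousWithinAt
  · rw [angAd]
    refine (abs_im_mul_le _ _).trans ?_
    calc ‖logPhase₁ (2 * π) ((a : ℂ) * d + b)‖ * ‖d‖ ≤ 1 / (R / 2) * ‖d‖ :=
          mul_le_mul_of_nonneg_right (hsz a ha).1 (norm_nonneg _)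
      _ = 2 * ‖d‖ / R := by rw [one_div, inv_div]; ring
  · rw [angAdd]
    refine (abs_im_mul_le _ _).trans ?_
    rw [norm_pow]
    calc ‖logPhase₂ (2 * π) ((a : ℂ) * d + b)‖ * ‖d‖ ^ 2 ≤ 1 / (R / 2) ^ 2 * ‖d‖ ^ 2 :=
          mul_le_mul_of_nonneg_right (hsz a ha).2 (by positivity)
      _ = 4 * ‖d‖ ^ 2 / R ^ 2 := by field_simp; ring

/-! ### The smooth weight `φ = g₀(|z|²) β(A_u(z))` along lines -/

/-- The domain of the smooth weight: the half-plane of `u` with `R²/2 < |z|² < 25R²`. [folklore] -/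
def wtDom (u : ℂ) (R : ℝ) : Set ℂ := {z : ℂ | z ∈ halfPlane u ∧ ‖z‖ ^ 2 ∈ radDom R}

/-- **The smooth weight** `φ(z) = g₀(|z|²) β(A_u(z))`. [folklore] -/
def wt (x R : ℝ) (u z : ℂ) : ℝ := radProf x R (‖z‖ ^ 2) * angB (angA u z)

/-- Its first derivative along a line of direction `d`. [folklore] -/
def wt₁ (x R : ℝ) (u d z : ℂ) : ℝ :=
  radProf₁ x R (‖z‖ ^ 2) * qd d z * angB (angA u z) + radProf x R (‖z‖ ^ 2) * (angB₁ (angA u z) * angAd d z)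

/-- Its second derivative along a line of direction `d`. [folklore] -/
def wt₂ (x R : ℝ) (u d z : ℂ) : ℝ :=
  (radProf₂ x R (‖z‖ ^ 2) * qd d z ^ 2 + radProf₁ x R (‖z‖ ^ 2) * (2 * ‖d‖ ^ 2)) * angB (angA u z)
    + 2 * (radProf₁ x R (‖z‖ ^ 2) * qd d z * (angB₁ (angA u z) * angAd d z))
    + radProf x R (‖z‖ ^ 2) * (angB₂ (angA u z) * angAd d z ^ 2 + angB₁ (angA u z) * angAdd d z)

/-- **The smooth weight along a line** `a ↦ ad + b`: two derivatives with
`|φ| ≤ 4/R`, `|φ_d| ≤ 372 C_S ‖d‖/R²`, `|φ_dd| ≤ 44000 C_S² ‖d‖²/R³` on `{a : ad + b ∈ wtDom u R}`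
(`R > 0`, `R² ≤ x`). [folklore] -/
theorem c2_wt_line {x R : ℝ} (hR : 0 < R) (hx : R ^ 2 ≤ x) (u d b : ℂ) :
    C2Bound {a : ℝ | (a : ℂ) * d + b ∈ wtDom u R} (fun a : ℝ => wt x R u ((a : ℂ) * d + b))
      (fun a => wt₁ x R u d ((a : ℂ) * d + b)) (fun a => wt₂ x R u d ((a : ℂ) * d + b))
      (4 / R) (372 * stepC * ‖d‖ / R ^ 2) (44000 * stepC ^ 2 * ‖d‖ ^ 2 / R ^ 3) := by
  have hC := one_le_stepC
  set U : Set ℝ := {a : ℝ | (a : ℂ) * d + b ∈ wtDom u R} with hU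
  have hq := (c2_normSq_line d b hR).mono (V := U) (fun a ha => ha.2) le_rfl le_rfl le_rfl
  have hA := (c2_angA_line u d b hR).mono (V := U) (fun a ha => ⟨ha.1, ha.2⟩) le_rfl le_rfl le_rfl
  have h1 := (c2_radProf hR hx).comp hq (fun a ha => ha.2)
  have h2 := c2_angB.comp hA (fun a _ => Set.mem_univ _)
  have h := h1.mul h2
  refine (h.congr ?_ ?_ ?_).mono subset_rfl ?_ ?_ ?_
  · funext a; rfl
  · funext a; simp only [pmul₁, pcomp₁, wt₁]
  · funext a; simp only [pmul₂, pcomp₁, pcomp₂, wt₂]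
  · rw [mul_one]
  · -- 18C/R³·(10R‖d‖)·1 + 4/R·(24C·(2‖d‖/R)) = 372 C ‖d‖/R²
    have e : 18 * stepC / R ^ 3 * (10 * R * ‖d‖) * 1 + 4 / R * (24 * stepC * (2 * ‖d‖ / R))
        = 372 * stepC * ‖d‖ / R ^ 2 := by field_simp; ring
    rw [e]
  · have hd := norm_nonneg d
    have e : (78 * stepC / R ^ 5 * (10 * R * ‖d‖) ^ 2 + 18 * stepC / R ^ 3 * (2 * ‖d‖ ^ 2)) * 1
          + 2 * (18 * stepC / R ^ 3 * (10 * R * ‖d‖) * (24 * stepC * (2 * ‖d‖ / R)))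
          + 4 / R * (1152 * stepC * (2 * ‖d‖ / R) ^ 2 + 24 * stepC * (4 * ‖d‖ ^ 2 / R ^ 2))
        = (26652 * stepC + 17280 * stepC ^ 2) * ‖d‖ ^ 2 / R ^ 3 := by field_simp; ring
    rw [e]
    refine div_le_div_of_nonneg_right ?_ (by positivity)
    refine mul_le_mul_of_nonneg_right ?_ (by positivity)
    nlinarith

/-- **Size of the smooth weight and of its line-derivatives on `wtDom`.** [folklore] -/
theorem wt_bounds {x R : ℝ} (hR : 0 < R) (hx : R ^ 2 ≤ x) (u d : ℂ) {z : ℂ} (hz : z ∈ wtDom u R) :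
    |wt x R u z| ≤ 4 / R ∧ |wt₁ x R u d z| ≤ 372 * stepC * ‖d‖ / R ^ 2 ∧
      |wt₂ x R u d z| ≤ 44000 * stepC ^ 2 * ‖d‖ ^ 2 / R ^ 3 := by
  have h := c2_wt_line hR hx u d z
  have h0 : (0 : ℝ) ∈ {a : ℝ | (a : ℂ) * d + z ∈ wtDom u R} := by simpa using hz
  have e : ((0 : ℝ) : ℂ) * d + z = z := by simp
  refine ⟨?_, ?_, ?_⟩
  · simpa [e] using h.b0 0 h0
  · simpa [e] using h.b1 0 h0
  · simpa [e] using h.b2 0 h0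

/-- **Line-derivatives of the smooth weight at a point of `wtDom`**, in the form used by `PieceHyp`
(`line a = a d + c e`). [folklore] -/
theorem wt_hasDerivAt {x R : ℝ} (hR : 0 < R) (hx : R ^ 2 ≤ x) (u d e : ℂ) (c a : ℝ)
    (ha : (a : ℂ) * d + (c : ℂ) * e ∈ wtDom u R) :
    HasDerivAt (fun a : ℝ => wt x R u ((a : ℂ) * d + (c : ℂ) * e)) (wt₁ x R u d ((a : ℂ) * d + (c : ℂ) * e)) a ∧
      HasDerivAt (fun a : ℝ => wt₁ x R u d ((a : ℂ) * d + (c : ℂ) * e)) (wt₂ x R u d ((a : ℂ) * d + (c : ℂ) * e)) a :=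
  ⟨(c2_wt_line hR hx u d ((c : ℂ) * e)).d1 a ha, (c2_wt_line hR hx u d ((c : ℂ) * e)).d2 a ha⟩

/-- `φ_dd` is continuous along chords inside `wtDom`. [folklore] -/
theorem wt₂_continuousOn {x R : ℝ} (hR : 0 < R) (hx : R ^ 2 ≤ x) (u d e : ℂ) (c : ℝ) {S : Set ℝ}
    (hS : ∀ a ∈ S, (a : ℂ) * d + (c : ℂ) * e ∈ wtDom u R) :
    ContinuousOn (fun a : ℝ => wt₂ x R u d ((a : ℂ) * d + (c : ℂ) * e)) S :=
  (c2_wt_line hR hx u d ((c : ℂ) * e)).cont.mono hS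

/-- **The smooth weight vanishes** unless `2R² < |z|² < 8R²` and `cos(24 A_u(z)) > -1/2`. [folklore] -/
theorem wt_eq_zero {x R : ℝ} (hR : 0 < R) (u : ℂ) {z : ℂ}
    (h : ‖z‖ ^ 2 ≤ 2 * R ^ 2 ∨ 8 * R ^ 2 ≤ ‖z‖ ^ 2 ∨ Real.cos (24 * angA u z) ≤ -(1 / 2)) : wt x R u z = 0 := by
  rw [wt]
  rcases h with h | h | h
  · rw [radProf_eq_zero hR (Or.inl h), zero_mul]
  · rw [radProf_eq_zero hR (Or.inr h), zero_mul]
  · rw [angB_eq_zero h, mul_zero]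

/-- **Lipschitz bound for the smooth weight** on a convex subset of `wtDom u R`:
`|φ(z) - φ(z')| ≤ 372 C_S ‖z - z'‖/R²`. [folklore] -/
theorem wt_lipschitz {x R : ℝ} (hR : 0 < R) (hx : R ^ 2 ≤ x) (u : ℂ) {S : Set ℂ} (hSc : Convex ℝ S)
    (hS : S ⊆ wtDom u R) {z z' : ℂ} (hz : z ∈ S) (hz' : z' ∈ S) :
    |wt x R u z - wt x R u z'| ≤ 372 * stepC / R ^ 2 * ‖z - z'‖ := by
  have hC := one_le_stepC
  have hP := c2_radProf hR hx
  obtain ⟨hzn, hzn'⟩ := norm_lt_of_radDom hR (hS hz).2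
  obtain ⟨hz'n, hz'n'⟩ := norm_lt_of_radDom hR (hS hz').2
  -- radial part
  have h1 : |radProf x R (‖z‖ ^ 2) - radProf x R (‖z'‖ ^ 2)| ≤ 18 * stepC / R ^ 3 * (10 * R * ‖z - z'‖) := by
    refine (hP.lipschitz (convex_Ioo _ _) (hS hz).2 (hS hz').2).trans ?_
    refine mul_le_mul_of_nonneg_left ?_ (by positivity)
    rw [show ‖z‖ ^ 2 - ‖z'‖ ^ 2 = (‖z‖ - ‖z'‖) * (‖z‖ + ‖z'‖) by ring, abs_mul,
      abs_of_nonneg (by positivity : 0 ≤ ‖z‖ + ‖z'‖)]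
    calc |‖z‖ - ‖z'‖| * (‖z‖ + ‖z'‖) ≤ ‖z - z'‖ * (10 * R) :=
          mul_le_mul (abs_norm_sub_norm_le _ _) (by linarith) (by positivity) (norm_nonneg _)
      _ = 10 * R * ‖z - z'‖ := by ring
  -- angular part
  have HC := logPhase_holChain (2 * π) u
  have h2 : |angA u z - angA u z'| ≤ 2 / R * ‖z - z'‖ := by
    have hmvt := hSc.norm_image_sub_le_of_norm_hasDerivWithin_le (f := logPhase (2 * π) u)
      (f' := logPhase₁ (2 * π)) (C := 2 / R)
      (fun w hw => (HC.d1 w (hS hw).1).hasDerivWithinAt) (fun w hw => ?_) hz' hz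
    · rw [angA, angA, ← Complex.sub_im]
      exact (Complex.abs_im_le_norm _).trans hmvt
    · have := (norm_logDeriv_le (by positivity : 0 < R / 2) (norm_lt_of_radDom hR (hS hw).2).2.le).1
      rw [one_div, inv_div] at this
      exact this
  have h3 : |angB (angA u z) - angB (angA u z')| ≤ 24 * stepC * (2 / R * ‖z - z'‖) :=
    (c2_angB.lipschitz convex_univ (Set.mem_univ _) (Set.mem_univ _)).trans
      (mul_le_mul_of_nonneg_left h2 (by positivity))
  -- combine
  have hr' : |radProf x R (‖z'‖ ^ 2)| ≤ 4 / R := hP.b0 _ (hS hz').2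
  have hb : |angB (angA u z)| ≤ 1 := by
    have := angB_mem (angA u z); rw [abs_le]; constructor <;> linarith
  rw [wt, wt]
  have hid : radProf x R (‖z‖ ^ 2) * angB (angA u z) - radProf x R (‖z'‖ ^ 2) * angB (angA u z')
      = (radProf x R (‖z‖ ^ 2) - radProf x R (‖z'‖ ^ 2)) * angB (angA u z)
        + radProf x R (‖z'‖ ^ 2) * (angB (angA u z) - angB (angA u z')) := by ring
  rw [hid]
  calc |(radProf x R (‖z‖ ^ 2) - radProf x R (‖z'‖ ^ 2)) * angB (angA u z)
        + radProf x R (‖z'‖ ^ 2) * (angB (angA u z) - angB (angA u z'))|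
      ≤ |radProf x R (‖z‖ ^ 2) - radProf x R (‖z'‖ ^ 2)| * |angB (angA u z)|
        + |radProf x R (‖z'‖ ^ 2)| * |angB (angA u z) - angB (angA u z')| := by
        refine (abs_add_le _ _).trans ?_; rw [abs_mul, abs_mul]
    _ ≤ 18 * stepC / R ^ 3 * (10 * R * ‖z - z'‖) * 1 + 4 / R * (24 * stepC * (2 / R * ‖z - z'‖)) :=
        add_le_add (mul_le_mul h1 hb (abs_nonneg _) (by positivity)) (mul_le_mul hr' h3 (abs_nonneg _) (by positivity))
    _ = 372 * stepC / R ^ 2 * ‖z - z'‖ := by field_simp; ring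

/-! ### The differenced weight `φ(z + h) φ(z)` -/

/-- The differenced weight. [folklore] -/
def wtH (x R : ℝ) (u h z : ℂ) : ℝ := wt x R u (z + h) * wt x R u z

/-- Its first line-derivative. [folklore] -/
def wtH₁ (x R : ℝ) (u h d z : ℂ) : ℝ := wt₁ x R u d (z + h) * wt x R u z + wt x R u (z + h) * wt₁ x R u d z

/-- Its second line-derivative. [folklore] -/
def wtH₂ (x R : ℝ) (u h d z : ℂ) : ℝ :=
  wt₂ x R u d (z + h) * wt x R u z + 2 * (wt₁ x R u d (z + h) * wt₁ x R u d z) + wt x R u (z + h) * wt₂ x R u d z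

/-- **The differenced weight along a line**: two derivatives with
`|φ_h| ≤ 16/R²`, `|(φ_h)_d| ≤ 2976 C_S ‖d‖/R³`, `|(φ_h)_dd| ≤ 630000 C_S² ‖d‖²/R⁴` on
`{a : ad + b ∈ wtDom, ad + b + h ∈ wtDom}`. [folklore] -/
theorem c2_wtH_line {x R : ℝ} (hR : 0 < R) (hx : R ^ 2 ≤ x) (u h d b : ℂ) :
    C2Bound {a : ℝ | (a : ℂ) * d + b ∈ wtDom u R ∧ (a : ℂ) * d + b + h ∈ wtDom u R}
      (fun a : ℝ => wtH x R u h ((a : ℂ) * d + b))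
      (fun a => wtH₁ x R u h d ((a : ℂ) * d + b)) (fun a => wtH₂ x R u h d ((a : ℂ) * d + b))
      (16 / R ^ 2) (2976 * stepC * ‖d‖ / R ^ 3) (630000 * stepC ^ 2 * ‖d‖ ^ 2 / R ^ 4) := by
  have hC := one_le_stepC
  set U : Set ℝ := {a : ℝ | (a : ℂ) * d + b ∈ wtDom u R ∧ (a : ℂ) * d + b + h ∈ wtDom u R} with hU
  have h0 := (c2_wt_line hR hx u d b).mono (V := U) (fun a ha => ha.1) le_rfl le_rfl le_rfl
  have h1' := c2_wt_line hR hx u d (b + h)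
  have h1 : C2Bound U (fun a : ℝ => wt x R u ((a : ℂ) * d + b + h)) (fun a => wt₁ x R u d ((a : ℂ) * d + b + h))
      (fun a => wt₂ x R u d ((a : ℂ) * d + b + h)) (4 / R) (372 * stepC * ‖d‖ / R ^ 2)
      (44000 * stepC ^ 2 * ‖d‖ ^ 2 / R ^ 3) := by
    have e : ∀ a : ℝ, (a : ℂ) * d + (b + h) = (a : ℂ) * d + b + h := fun a => by ring
    refine (h1'.mono (V := U) (fun a ha => by show (a : ℂ) * d + (b + h) ∈ wtDom u R; rw [e]; exact ha.2)
      le_rfl le_rfl le_rfl).congr ?_ ?_ ?_ <;> funext a <;> simp only [e]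
  have hm := h1.mul h0
  refine (hm.congr ?_ ?_ ?_).mono subset_rfl ?_ ?_ ?_
  · funext a; simp only [wtH]
  · funext a; simp only [pmul₁, wtH₁]
  · funext a; simp only [pmul₂, wtH₂]
  · exact le_of_eq (by field_simp; ring)
  · exact le_of_eq (by field_simp; ring)
  · have hd := norm_nonneg d
    have e : 44000 * stepC ^ 2 * ‖d‖ ^ 2 / R ^ 3 * (4 / R)
          + 2 * (372 * stepC * ‖d‖ / R ^ 2 * (372 * stepC * ‖d‖ / R ^ 2))
          + 4 / R * (44000 * stepC ^ 2 * ‖d‖ ^ 2 / R ^ 3)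
        = 628768 * stepC ^ 2 * ‖d‖ ^ 2 / R ^ 4 := by field_simp; ring
    rw [e]
    refine div_le_div_of_nonneg_right ?_ (by positivity)
    nlinarith [sq_nonneg stepC, sq_nonneg ‖d‖, mul_nonneg (sq_nonneg stepC) (sq_nonneg ‖d‖)]

/-- **Lipschitz bound for the differenced weight** on a convex `S` with `S ⊆ wtDom`, `S + h ⊆ wtDom`:
`|φ_h(z) - φ_h(z')| ≤ 2976 C_S ‖z - z'‖/R³`. [folklore] -/
theorem wtH_lipschitz {x R : ℝ} (hR : 0 < R) (hx : R ^ 2 ≤ x) (u h : ℂ) {S : Set ℂ} (hSc : Convex ℝ S)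
    (hS : S ⊆ wtDom u R) (hSh : ∀ z ∈ S, z + h ∈ wtDom u R) {z z' : ℂ} (hz : z ∈ S) (hz' : z' ∈ S) :
    |wtH x R u h z - wtH x R u h z'| ≤ 2976 * stepC / R ^ 3 * ‖z - z'‖ := by
  have hC := one_le_stepC
  -- the translate of `S`
  have hSc' : Convex ℝ ((fun w => w + h) '' S) := by
    have : (fun w : ℂ => w + h) = fun w => h + w := funext fun w => add_comm w h
    rw [this]; exact hSc.translate h
  have hS' : (fun w => w + h) '' S ⊆ wtDom u R := by
    rintro w ⟨v, hv, rfl⟩; exact hSh v hv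
  have h1 := wt_lipschitz hR hx u hSc' hS' (Set.mem_image_of_mem _ hz) (Set.mem_image_of_mem _ hz')
  have h2 := wt_lipschitz hR hx u hSc hS hz hz'
  have e1 : z + h - (z' + h) = z - z' := by ring
  rw [e1] at h1
  have b1 : |wt x R u z| ≤ 4 / R := (wt_bounds hR hx u 1 (hS hz)).1
  have b2 : |wt x R u (z' + h)| ≤ 4 / R := (wt_bounds hR hx u 1 (hSh z' hz')).1
  rw [wtH, wtH]
  have hid : wt x R u (z + h) * wt x R u z - wt x R u (z' + h) * wt x R u z'
      = (wt x R u (z + h) - wt x R u (z' + h)) * wt x R u z + wt x R u (z' + h) * (wt x R u z - wt x R u z') := by ring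
  rw [hid]
  calc |(wt x R u (z + h) - wt x R u (z' + h)) * wt x R u z + wt x R u (z' + h) * (wt x R u z - wt x R u z')|
      ≤ |wt x R u (z + h) - wt x R u (z' + h)| * |wt x R u z| + |wt x R u (z' + h)| * |wt x R u z - wt x R u z'| := by
        refine (abs_add_le _ _).trans ?_; rw [abs_mul, abs_mul]
    _ ≤ 372 * stepC / R ^ 2 * ‖z - z'‖ * (4 / R) + 4 / R * (372 * stepC / R ^ 2 * ‖z - z'‖) :=
        add_le_add (mul_le_mul h1 b1 (abs_nonneg _) (by positivity)) (mul_le_mul b2 h2 (abs_nonneg _) (by positivity))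
    _ = 2976 * stepC / R ^ 3 * ‖z - z'‖ := by field_simp; ring


end VdC
end Literature.NumberTheory.LFunctions

end
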